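import Summits.SmoothPoincare4.SmoothPoincare4.Theses.SblfDescent
import Literature.Topology.FourManifolds.SimplifiedBrokenLefschetzFibration
import Literature.Topology.FourManifolds.HomotopyS4CompactProofs
import Literature.Topology.FourManifolds.SphereSimplyConnected
import Literature.Topology.FourManifolds.SmoothOrientationProofs
import Literature.Topology.FourManifolds.SimplifiedBrokenLefschetzExistence

/-!
# `SblfExists` (support of route SblfDescent): reduction to the existence theorem for
# simplified broken Lefschetz fibrations

Item `stmt-SmoothPoincare4-18530` (`Summit.SmoothPoincare4.SmoothPoincare4.Theses.SblfDescent.SblfExists`):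
every smooth homotopy 4-sphere `M` admits a simplified broken Lefschetz fibration `f : M → S²`
with non-empty round locus, of some lower genus `h` (the route's inline reading `HAS(M, h)`, which
is field for field `Literature.Topology.FourManifolds.IsSimplifiedBrokenLefschetzFibration o f L h`).
In print this is the existence theorem for simplified broken Lefschetz fibrations on ALL closed
connected oriented 4-manifolds (Baykur 2008, Lekili, Akbulut–Karakurt, Williams 2010; in the
explicit form with prescribed NON-EMPTY round locus: Baykur–Saeki, arXiv:1705.11169, Thm. 6.1 and
Cor. 6.2), specialised to homotopy spheres.  This file:

* `exists_isSimplifiedBrokenLefschetzFibration` — the NAMED FACT (Baykur–Saeki 2017, Thm. 6.1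
  with Cor. 6.2), stated over the tree's `IsSimplifiedBrokenLefschetzFibration`;
* `sblfExists_of_exists_isSimplifiedBrokenLefschetzFibration` — the item follows from the fact:
  a homotopy 4-sphere is compact (`compactSpace_of_homotopyEquiv_sphere_four_holds`), path
  connected, simply connected (`simplyConnectedSpace_sphere_four_holds` and homotopy invariance)
  hence orientable (`isOrientable_of_simplyConnectedSpace_holds`) — all PROVED in the tree — so
  the fact applies with any orientation `o`, and the structure unpacks to the route's inline
  reading definitionally.  The item is thereby closed modulo that one fact (conditional result;
  its discharge = formalising Baykur–Saeki's singularity-theoretic construction, an XL port).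
-/

noncomputable section

-- the prescribed namespace `Summit.<P>.<Sub>.…` duplicates `SmoothPoincare4` (P = Sub)
set_option linter.dupNamespace false

open scoped Manifold ContDiff Topology ContinuousMap
open Literature.Topology.FourManifolds

namespace Summit.SmoothPoincare4.SmoothPoincare4.Theorems

/-! ### The named fact: existence of simplified broken Lefschetz fibrations -/

/-- **`SblfExists` from the existence of simplified broken Lefschetz fibrations** (Baykur–Saeki
2017, Thm. 6.1 and Cor. 6.2, applied to a homotopy 4-sphere): GIVEN the named fact
`exists_isSimplifiedBrokenLefschetzFibration`, every Hausdorff second-countable smooth 4-manifold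
`M ≃ₕ S⁴` admits a simplified broken Lefschetz fibration with non-empty round locus of some lower
genus `h`, in the route's inline reading.  Proof: `M` is compact
(`compactSpace_of_homotopyEquiv_sphere_four_holds`, Hatcher Prop. 3.29 with Cor. 2.11/2.14),
path connected and simply connected (`pathConnectedSpace_of_homotopyEquiv`,
`simplyConnectedSpace_sphere_four_holds`, Hatcher Prop. 1.14/1.18), hence orientable
(`isOrientable_of_simplyConnectedSpace_holds`, Lee Thm. 15.43); apply the fact to `M` with such
an orientation `o` and unpack the structure `IsSimplifiedBrokenLefschetzFibration o f L h`, whose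
fields are the route's clauses verbatim.  Conditional on the named fact only.
[cite: BaykurSaeki2017, Thm. 6.1 and Cor. 6.2] -/
theorem sblfExists_of_exists_isSimplifiedBrokenLefschetzFibration
    (hX : Literature.Topology.FourManifolds.exists_isSimplifiedBrokenLefschetzFibration) :
    Summit.SmoothPoincare4.SmoothPoincare4.Theses.SblfDescent.SblfExists := by
  intro M _ _ _ _ _ e
  haveI : CompactSpace M := compactSpace_of_homotopyEquiv_sphere_four_holds M e
  haveI : PathConnectedSpace (Metric.sphere (0 : EuclideanSpace ℝ (Fin 5)) 1) :=
    pathConnectedSpace_sphere_four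
  haveI : PathConnectedSpace M := pathConnectedSpace_of_homotopyEquiv e
  haveI : SimplyConnectedSpace (Metric.sphere (0 : EuclideanSpace ℝ (Fin 5)) 1) :=
    simplyConnectedSpace_sphere_four_holds
  haveI : SimplyConnectedSpace M := e.simplyConnectedSpace
  obtain ⟨o⟩ := (isOrientable_of_simplyConnectedSpace_holds (I := 𝓡 4) (M := M) :
    IsOrientable (𝓡 4) M)
  obtain ⟨h, f, L, hf⟩ := hX M o
  refine ⟨h, o, f, L, ?_⟩
  intro R G
  exact ⟨hf.contMDiff, hf.surjective, hf.lefschetz, hf.fold, hf.isConnected_round, hf.injOn_crit,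
    hf.fibre, hf.exists_higher, hf.exists_lower, hf.lefschetz_higher⟩

end Summit.SmoothPoincare4.SmoothPoincare4.Theorems

end

/-! ### The item is EXACTLY the existence statement on homotopy 4-spheres

`SblfExists` quantifies `∃ h, ∃ o f L, HAS-clauses`; the clauses are, in order, the fields of
`IsSimplifiedBrokenLefschetzFibration o f L h`.  So the route decl is interderivable with the
existence of a simplified broken Lefschetz fibration (in the tree's sense, for SOME smooth
orientation and some lower genus) on every Hausdorff second-countable smooth `M ≃ₕ S⁴` — the
named fact `exists_isSimplifiedBrokenLefschetzFibration` restricted to homotopy 4-spheres, up to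
`∀ o` there versus `∃ o` here (immaterial: a simply connected manifold is orientable, see the
bridge above).  This records that the reduction of the item to the named fact loses nothing on the
summit side: what remains is the existence theorem itself (Williams 2010; Baykur–Saeki 2017,
Thm. 6.1 / Cor. 6.2), not any bookkeeping about homotopy spheres. -/

noncomputable section

-- the prescribed namespace `Summit.<P>.<Sub>.…` duplicates `SmoothPoincare4` (P = Sub)
set_option linter.dupNamespace false

open scoped Manifold ContDiff Topology ContinuousMap
open Literature.Topology.FourManifolds

namespace Summit.SmoothPoincare4.SmoothPoincare4.Theorems

/-- **`SblfExists` is equivalent to: every smooth homotopy 4-sphere carries a simplified broken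
Lefschetz fibration** (tree reading `IsSimplifiedBrokenLefschetzFibration o f L h` for some smooth
orientation `o`, some `f : M → S²`, finite Lefschetz set `L` and lower genus `h`).  Both
directions are field-by-field repackaging of the route's inline clauses (`let R … let G …` unfold
definitionally to the structure's fields); no mathematics enters.  Use: `.mpr` turns any future
in-tree construction of SBLFs on homotopy spheres into the item, `.mp` shows the item is not
weaker than that. [folklore] -/
theorem sblfExists_iff :
    Summit.SmoothPoincare4.SmoothPoincare4.Theses.SblfDescent.SblfExists ↔
      ∀ (M : Type) [TopologicalSpace M] [T2Space M] [SecondCountableTopology M]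
        [ChartedSpace (EuclideanSpace ℝ (Fin 4)) M] [IsManifold (𝓡 4) ∞ M],
        M ≃ₕ Metric.sphere (0 : EuclideanSpace ℝ (Fin 5)) 1 →
        ∃ (o : SmoothOrientation (𝓡 4) M) (f : M → Metric.sphere (0 : EuclideanSpace ℝ (Fin 3)) 1)
          (L : Finset M) (h : ℕ), IsSimplifiedBrokenLefschetzFibration o f L h := by
  constructor
  · intro H M _ _ _ _ _ e
    obtain ⟨h, o, f, L, h1, h2, h3, h4, h5, h6, h7, h8, h9, h10⟩ := H M e
    exact ⟨o, f, L, h, ⟨h1, h2, h3, h4, h5, h6, h7, h8, h9, h10⟩⟩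
  · intro H M _ _ _ _ _ e
    obtain ⟨o, f, L, h, hf⟩ := H M e
    refine ⟨h, o, f, L, ?_⟩
    intro R G
    exact ⟨hf.contMDiff, hf.surjective, hf.lefschetz, hf.fold, hf.isConnected_round, hf.injOn_crit,
      hf.fibre, hf.exists_higher, hf.exists_lower, hf.lefschetz_higher⟩

/-- **The named fact, read on homotopy 4-spheres, in the route's own words.**  GIVEN
`exists_isSimplifiedBrokenLefschetzFibration` (Baykur–Saeki 2017, Thm. 6.1 / Cor. 6.2), every
smooth `M ≃ₕ S⁴` carries, for EVERY smooth orientation `o` (not just some), a simplified broken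
Lefschetz fibration of some lower genus: `M` is compact (`compactSpace_of_homotopyEquiv_sphere_four_holds`)
and connected (path connected by transport along `e`), so the fact applies verbatim.  This is the
`∀ o` strengthening of the bridge `sblfExists_of_exists_isSimplifiedBrokenLefschetzFibration`,
useful to rungs that fix the orientation first (positivity of the Lefschetz points is read against
`o`).  Conditional on the named fact only. [cite: BaykurSaeki2017, Thm. 6.1 and Cor. 6.2] -/
theorem exists_sblf_of_homotopyEquiv_sphere_four
    (hX : Literature.Topology.FourManifolds.exists_isSimplifiedBrokenLefschetzFibration)
    (M : Type) [TopologicalSpace M] [T2Space M] [SecondCountableTopology M]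
    [ChartedSpace (EuclideanSpace ℝ (Fin 4)) M] [IsManifold (𝓡 4) ∞ M]
    (e : M ≃ₕ Metric.sphere (0 : EuclideanSpace ℝ (Fin 5)) 1) (o : SmoothOrientation (𝓡 4) M) :
    ∃ (h : ℕ) (f : M → Metric.sphere (0 : EuclideanSpace ℝ (Fin 3)) 1) (L : Finset M),
      IsSimplifiedBrokenLefschetzFibration o f L h := by
  haveI : CompactSpace M := compactSpace_of_homotopyEquiv_sphere_four_holds M e
  haveI : PathConnectedSpace (Metric.sphere (0 : EuclideanSpace ℝ (Fin 5)) 1) :=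
    pathConnectedSpace_sphere_four
  haveI : PathConnectedSpace M := pathConnectedSpace_of_homotopyEquiv e
  exact hX M o

end Summit.SmoothPoincare4.SmoothPoincare4.Theorems

end
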